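import Mathlib
import Summits.Ventures.HodgeRepro.OcticCMPointTruncModel
import Summits.Ventures.HodgeRepro.OcticCMPointTruncTwist

/-!
# OcticCMPointTruncFour — the Gauss sum of the explicit twist at conductor `4` on `𝒪/𝔭⁴`, evaluated

Blind re-derivation cell `pub-hodge-repro`, seat night-2 (gen 4).  Target tree path
`lean/Summits/Ventures/HodgeRepro/OcticCMPointTruncFour.lean`.  Continues `OcticCMPointTruncTwist.lean` on
`Trunc k 4 = k[ϖ]/(ϖ⁴)` (`𝒪/𝔭⁴` at `𝔭₁, 𝔭₂ | 5`, `k = 𝔽₅` — the conductor ROUTE-B §9.9 (d) needs for tame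
lines: `c ≥ 2 · 1 + 2`).

* `ofCoords a b c d = a + bϖ + cϖ² + dϖ³` and `coords : Trunc k 4 ≃ k × k × k × k` (coefficients ↔ elements);
* `coeffAt_three_trLog`: `(trLog (bϖ + cϖ² + dϖ³))₃ = d − b c + b³/3` (`z² = b²ϖ² + 2bc ϖ³`, `z³ = b³ϖ³`);
* **`gaussSum_twist_four`**: for the wild twist `ρ = twist 1 ψ₀` (`θ = 1`) and `ψ₀` primitive,
  `∑_{x} ρ⁻¹(x) ψ̃(x) = |k|²` — write `x = a(1 + z)`, sum over `d` (forces `a = 1`), then over `c` (forces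
  `b = 0`): the stationary phase at an EVEN conductor is a single point, no quadratic Gauss sum appears;
* **`eps_twist_four`**: Kudla's `ε(s, ρ, ψ)` on the model is `ρ(ϖ)^n · κ · |k|²`, and with `κ = |R|^{−1/2}
  = |k|^{−2}` the local root number of the conductor-`4` twist is EXACTLY `ρ(ϖ)^n`.  With gen 1's stability
  (`eps_mul_eq`: `ε(χ ρ) = χ(ϖ)^n χ(1)^{−1} ε(ρ)`) every tame line's twisted root number at `𝔭 | 5` is then
  `(χ(ϖ) ρ(ϖ))^n` — (E2) and (E3) at the ramified places of the octic point in closed form for the tame lines.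

**What this is not.**  `c = 3` (a quadratic Gauss sum appears), `c ≥ 5` and `𝔮 | 2` are not covered; the
tame parts `θ ≠ 1` of the twist are not evaluated here (they multiply the sum by `θ(1)^{−1} = 1` after the
stationary phase — left for the record).  Nothing here says anything about the status of the Hodge conjecture
for CM abelian varieties, which is NOT proved.
-/

set_option autoImplicit false

noncomputable section

open Finset Polynomial

namespace Summit.Ventures.HodgeRepro.PeriodCloser

open GaussSumStability

namespace TruncModel

variable {k : Type} [Field k]

/-! ### Coordinates on `k[ϖ]/(ϖ⁴)` -/

/-- `a + bϖ + cϖ² + dϖ³`. -/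
def ofCoords (a b c d : k) : Trunc k 4 :=
  algebraMap k (Trunc k 4) a + algebraMap k (Trunc k 4) b * varpi 4 ^ 1 +
    algebraMap k (Trunc k 4) c * varpi 4 ^ 2 + algebraMap k (Trunc k 4) d * varpi 4 ^ 3

/-- `coeffAt i (ϖ^j) = [i = j]` for `i < c`. -/
theorem coeffAt_varpi_pow (c : ℕ) (i : ℕ) (hi : i < c) (j : ℕ) :
    coeffAt c i ((varpi c : Trunc k c) ^ j) = if i = j then 1 else 0 := by
  rw [varpi, ← AdjoinRoot.mk_X, ← map_pow, coeffAt_mk_of_lt c _ hi, coeff_X_pow]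

/-- `coeffAt i (algebraMap a) = [i = 0] a` for `i < c`. -/
theorem coeffAt_algebraMap (c : ℕ) (i : ℕ) (hi : i < c) (a : k) :
    coeffAt c i (algebraMap k (Trunc k c) a) = if i = 0 then a else 0 := by
  rw [AdjoinRoot.algebraMap_eq, ← AdjoinRoot.mk_C, coeffAt_mk_of_lt c _ hi, coeff_C]

/-- The same for `AdjoinRoot.of`. -/
theorem coeffAt_of (c : ℕ) (i : ℕ) (hi : i < c) (a : k) :
    coeffAt c i (AdjoinRoot.of (X ^ c : k[X]) a) = if i = 0 then a else 0 := by
  rw [← AdjoinRoot.algebraMap_eq, coeffAt_algebraMap c i hi]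

/-- `coeffAt i (ofCoords a b c d)` in general. -/
theorem coeffAt_ofCoords_eq (a b c d : k) (i : ℕ) (hi : i < 4) :
    coeffAt 4 i (ofCoords a b c d) = (if i = 0 then a else 0) + b * (if i = 1 then 1 else 0) +
      c * (if i = 2 then 1 else 0) + d * (if i = 3 then 1 else 0) := by
  rw [ofCoords, map_add, map_add, map_add, coeffAt_algebraMap_mul, coeffAt_algebraMap_mul, coeffAt_algebraMap_mul,
    coeffAt_algebraMap 4 i hi, coeffAt_varpi_pow 4 i hi, coeffAt_varpi_pow 4 i hi, coeffAt_varpi_pow 4 i hi]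

/-- The coordinates of `ofCoords a b c d`. -/
theorem coeffAt_ofCoords (a b c d : k) :
    coeffAt 4 0 (ofCoords a b c d) = a ∧ coeffAt 4 1 (ofCoords a b c d) = b ∧
      coeffAt 4 2 (ofCoords a b c d) = c ∧ coeffAt 4 3 (ofCoords a b c d) = d := by
  refine ⟨?_, ?_, ?_, ?_⟩
  · rw [coeffAt_ofCoords_eq a b c d 0 (by norm_num)]; norm_num
  · rw [coeffAt_ofCoords_eq a b c d 1 (by norm_num)]; norm_num
  · rw [coeffAt_ofCoords_eq a b c d 2 (by norm_num)]; norm_num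
  · rw [coeffAt_ofCoords_eq a b c d 3 (by norm_num)]; norm_num

/-- Every element of `k[ϖ]/(ϖ⁴)` is `ofCoords` of its coordinates. -/
theorem eq_ofCoords (x : Trunc k 4) :
    x = ofCoords (coeffAt 4 0 x) (coeffAt 4 1 x) (coeffAt 4 2 x) (coeffAt 4 3 x) := by
  obtain ⟨p, rfl, hp⟩ := exists_rep 4 (by norm_num) x
  simp only [coeffAt_mk_of_lt 4 p (show (0 : ℕ) < 4 by norm_num), coeffAt_mk_of_lt 4 p (show (1 : ℕ) < 4 by norm_num),
    coeffAt_mk_of_lt 4 p (show (2 : ℕ) < 4 by norm_num), coeffAt_mk_of_lt 4 p (show (3 : ℕ) < 4 by norm_num)]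
  conv_lhs => rw [p.as_sum_range' 4 hp]
  simp only [Finset.sum_range_succ, Finset.sum_range_zero, zero_add, map_add, ← C_mul_X_pow_eq_monomial,
    map_mul, map_pow, AdjoinRoot.mk_C, AdjoinRoot.mk_X, ofCoords, AdjoinRoot.algebraMap_eq, pow_zero, mul_one]

/-- **The coordinates** `k[ϖ]/(ϖ⁴) ≃ k⁴`. -/
def coords : Trunc k 4 ≃ k × k × k × k where
  toFun x := (coeffAt 4 0 x, coeffAt 4 1 x, coeffAt 4 2 x, coeffAt 4 3 x)
  invFun v := ofCoords v.1 v.2.1 v.2.2.1 v.2.2.2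
  left_inv x := (eq_ofCoords x).symm
  right_inv v := by
    obtain ⟨a, b, c, d⟩ := v
    obtain ⟨h0, h1, h2, h3⟩ := coeffAt_ofCoords a b c d
    simp only [h0, h1, h2, h3]

/-- `coords.symm (a, b, c, d) = ofCoords a b c d`. -/
theorem coords_symm_apply (a b c d : k) : coords.symm (a, b, c, d) = ofCoords a b c d := rfl

/-! ### The top coefficient of the logarithm in coordinates -/

/-- `ϖ⁴ = 0` in `k[ϖ]/(ϖ⁴)`. -/
theorem varpi_four : (varpi 4 : Trunc k 4) ^ 4 = 0 := varpi_pow_c 4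

/-- `(bϖ + cϖ² + dϖ³)² = b²ϖ² + 2bc ϖ³`. -/
theorem ofCoords_zero_sq (b c d : k) :
    ofCoords 0 b c d ^ 2 = ofCoords 0 0 (b ^ 2) (2 * b * c) := by
  have h4 : (varpi 4 : Trunc k 4) ^ 4 = 0 := varpi_four
  simp only [ofCoords, map_zero, zero_add, map_pow, map_mul, map_ofNat]
  linear_combination (algebraMap k (Trunc k 4) c ^ 2 + 2 * algebraMap k (Trunc k 4) b * algebraMap k (Trunc k 4) d +
    2 * algebraMap k (Trunc k 4) c * algebraMap k (Trunc k 4) d * varpi 4 +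
    algebraMap k (Trunc k 4) d ^ 2 * varpi 4 ^ 2) * h4

/-- `(bϖ + cϖ² + dϖ³)³ = b³ϖ³`. -/
theorem ofCoords_zero_cube (b c d : k) : ofCoords 0 b c d ^ 3 = ofCoords 0 0 0 (b ^ 3) := by
  have h4 : (varpi 4 : Trunc k 4) ^ 4 = 0 := varpi_four
  simp only [ofCoords, map_zero, zero_add, map_pow]
  set B := algebraMap k (Trunc k 4) b
  set C' := algebraMap k (Trunc k 4) c
  set D := algebraMap k (Trunc k 4) d
  set w := (varpi 4 : Trunc k 4)
  linear_combination (3 * B ^ 2 * C' + 3 * B ^ 2 * D * w + 3 * B * C' ^ 2 * w + 6 * B * C' * D * w ^ 2 +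
    C' ^ 3 * w ^ 2 + 3 * B * D ^ 2 * w ^ 3 + 3 * C' ^ 2 * D * w ^ 3 + 3 * C' * D ^ 2 * w ^ 4 + D ^ 3 * w ^ 5) * h4

/-- **The top coefficient of the logarithm**: `(trLog (bϖ + cϖ² + dϖ³))₃ = d − b c + b³/3` (`2, 3 ≠ 0`). -/
theorem coeffAt_three_trLog (h2 : (2 : k) ≠ 0) (b c d : k) :
    coeffAt 4 3 (trLog 4 (ofCoords 0 b c d)) = d - b * c + (3 : k)⁻¹ * b ^ 3 := by
  rw [trLog, ofCoords_zero_sq, ofCoords_zero_cube, map_add, map_sub, coeffAt_algebraMap_mul, coeffAt_algebraMap_mul,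
    (coeffAt_ofCoords 0 b c d).2.2.2, (coeffAt_ofCoords 0 0 (b ^ 2) (2 * b * c)).2.2.2,
    (coeffAt_ofCoords 0 0 0 (b ^ 3)).2.2.2]
  field_simp

/-! ### The twist in coordinates -/

/-- `ofCoords a b c d` is a unit iff `a ≠ 0`. -/
theorem isUnit_ofCoords_iff (a b c d : k) : IsUnit (ofCoords a b c d) ↔ a ≠ 0 := by
  rw [← not_iff_not, not_not, ← hloc 4 (by norm_num), mem_maxIdeal_iff_coeff 4 (by norm_num),
    (coeffAt_ofCoords a b c d).1]

/-- `red (a + bϖ + cϖ² + dϖ³) = (b/a)ϖ + (c/a)ϖ² + (d/a)ϖ³` for `a ≠ 0`. -/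
theorem red_ofCoords {a : k} (ha : a ≠ 0) (b c d : k) :
    red 4 (ofCoords a b c d) = ofCoords 0 (a⁻¹ * b) (a⁻¹ * c) (a⁻¹ * d) := by
  rw [red, (coeffAt_ofCoords a b c d).1]
  simp only [ofCoords, map_zero, zero_add, mul_add, ← mul_assoc, ← map_mul, inv_mul_cancel₀ ha, map_one]
  ring

/-- `ψ̃(a + bϖ + cϖ² + dϖ³) = ψ₀(d)`. -/
theorem psiTilde_ofCoords (ψ₀ : AddChar k ℂ) (a b c d : k) : psiTilde 4 ψ₀ (ofCoords a b c d) = ψ₀ d := by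
  rw [psiTilde_apply, (coeffAt_ofCoords a b c d).2.2.2]

/-- **The wild twist in coordinates**: for `a ≠ 0`,
`ρ(a + bϖ + cϖ² + dϖ³) = ψ₀(d/a − (b/a)(c/a) + (b/a)³/3)`. -/
theorem twist_one_ofCoords (h2 : (2 : k) ≠ 0) (h3 : (3 : k) ≠ 0) (ψ₀ : AddChar k ℂ) {a : k} (ha : a ≠ 0)
    (b c d : k) :
    twist 4 (by norm_num) (by norm_num) h2 h3 1 ψ₀ (ofCoords a b c d) =
      ψ₀ (a⁻¹ * d - (a⁻¹ * b) * (a⁻¹ * c) + (3 : k)⁻¹ * (a⁻¹ * b) ^ 3) := by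
  rw [twist_apply, if_pos ((isUnit_ofCoords_iff a b c d).2 ha), (coeffAt_ofCoords a b c d).1,
    MulChar.one_apply (isUnit_iff_ne_zero.2 ha), one_mul, red_ofCoords ha, coeffAt_three_trLog h2]

/-- The twist vanishes off the units: `ρ(0 + bϖ + cϖ² + dϖ³) = 0`. -/
theorem twist_one_ofCoords_zero (h2 : (2 : k) ≠ 0) (h3 : (3 : k) ≠ 0) (ψ₀ : AddChar k ℂ) (b c d : k) :
    twist 4 (by norm_num) (by norm_num) h2 h3 1 ψ₀ (ofCoords 0 b c d) = 0 := by
  apply MulChar.map_nonunit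
  rw [isUnit_ofCoords_iff]
  exact fun h => h rfl

/-! ### The Gauss sum of the wild twist at conductor `4` -/

/-- The summand of the Gauss sum in coordinates. -/
theorem gauss_term [DecidableEq k] (h2 : (2 : k) ≠ 0) (h3 : (3 : k) ≠ 0) (ψ₀ : AddChar k ℂ) (a b c d : k) :
    (twist 4 (by norm_num) (by norm_num) h2 h3 1 ψ₀)⁻¹ (ofCoords a b c d) * psiTilde 4 ψ₀ (ofCoords a b c d) =
      if a = 0 then 0 else
        ψ₀ ((a⁻¹ * b) * (a⁻¹ * c) - (3 : k)⁻¹ * (a⁻¹ * b) ^ 3) * ψ₀ (d * (1 - a⁻¹)) := by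
  rw [MulChar.inv_apply_eq_inv', psiTilde_ofCoords]
  by_cases ha : a = 0
  · subst ha
    rw [if_pos rfl, twist_one_ofCoords_zero, inv_zero, zero_mul]
  · rw [if_neg ha, twist_one_ofCoords h2 h3 ψ₀ ha, ← AddChar.map_neg_eq_inv, ← AddChar.map_add_eq_mul,
      ← AddChar.map_add_eq_mul]
    congr 1
    ring

/-- **The Gauss sum of the wild twist at conductor `4` is `|k|²`** (`ψ₀` primitive): the sum over `d` forces
`a = 1` (`AddChar.sum_mulShift`), the sum over `c` then forces `b = 0`. -/
theorem gaussSum_twist_four [Fintype k] [DecidableEq k] (h2 : (2 : k) ≠ 0) (h3 : (3 : k) ≠ 0)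
    (ψ₀ : AddChar k ℂ) (h₀ : ψ₀.IsPrimitive) :
    gaussSum (twist 4 (by norm_num) (by norm_num) h2 h3 1 ψ₀)⁻¹ (psiTilde 4 ψ₀) = (Fintype.card k : ℂ) ^ 2 := by
  unfold gaussSum
  rw [← Equiv.sum_comp coords.symm]
  simp only [Fintype.sum_prod_type]
  simp only [coords_symm_apply, gauss_term h2 h3 ψ₀]
  -- the sum over `d`
  have hd : ∀ a b c : k, (∑ d : k, if a = 0 then (0 : ℂ) else
      ψ₀ ((a⁻¹ * b) * (a⁻¹ * c) - (3 : k)⁻¹ * (a⁻¹ * b) ^ 3) * ψ₀ (d * (1 - a⁻¹))) =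
      if a = 1 then (Fintype.card k : ℂ) * ψ₀ (b * c - (3 : k)⁻¹ * b ^ 3) else 0 := by
    intro a b c
    by_cases ha : a = 0
    · subst ha
      simp only [if_true, Finset.sum_const_zero, zero_ne_one, if_false]
    · simp only [ha, if_false]
      rw [← Finset.mul_sum, AddChar.sum_mulShift _ h₀]
      by_cases ha1 : a = 1
      · subst ha1
        simp only [inv_one, sub_self, if_true, mul_one, mul_comm]
      · have : (1 : k) - a⁻¹ ≠ 0 := by
          intro h
          apply ha1
          have : a⁻¹ = 1 := by linear_combination -h
          rwa [inv_eq_one] at this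
        simp only [this, if_false, Nat.cast_zero, mul_zero, ha1]
  simp only [hd]
  -- the sum over `a`
  rw [Finset.sum_eq_single (1 : k) (fun a _ ha => by simp only [ha, if_false, Finset.sum_const_zero])
    (fun h => absurd (Finset.mem_univ _) h)]
  simp only [if_true]
  -- the sum over `c`, then `b`
  have hc : ∀ b : k, (∑ c : k, (Fintype.card k : ℂ) * ψ₀ (b * c - (3 : k)⁻¹ * b ^ 3)) =
      (Fintype.card k : ℂ) * (ψ₀ (-((3 : k)⁻¹ * b ^ 3)) * if b = 0 then (Fintype.card k : ℂ) else 0) := by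
    intro b
    rw [← Finset.mul_sum]
    congr 1
    have : ∀ c : k, ψ₀ (b * c - (3 : k)⁻¹ * b ^ 3) = ψ₀ (-((3 : k)⁻¹ * b ^ 3)) * ψ₀ (c * b) := by
      intro c
      rw [← AddChar.map_add_eq_mul]
      congr 1
      ring
    simp only [this]
    rw [← Finset.mul_sum, AddChar.sum_mulShift _ h₀]
    split_ifs <;> simp
  simp only [hc]
  rw [Finset.sum_eq_single (0 : k) (fun b _ hb => by simp only [hb, if_false, mul_zero])
    (fun h => absurd (Finset.mem_univ _) h)]
  simp only [if_true, zero_pow (three_ne_zero), mul_zero, neg_zero, AddChar.map_zero_eq_one, one_mul, sq]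

/-! ### The local root number of the conductor-`4` twist, and of the twisted tame lines -/

/-- **Kudla's `ε(s, ρ, ψ)` of the conductor-`4` wild twist on the model** (Prop. 3.8 (ii), p0109:L3–L11):
`ε = ρ(ϖ)^n · κ · |k|²`. -/
theorem eps_twist_four [Fintype k] [DecidableEq k] (h2 : (2 : k) ≠ 0) (h3 : (3 : k) ≠ 0) (ψ₀ : AddChar k ℂ)
    (h₀ : ψ₀.IsPrimitive) (κ : ℂ) (n : ℕ) (π : ℂ) :
    LocalChar.eps κ n (⟨twist 4 (by norm_num) (by norm_num) h2 h3 1 ψ₀, π⟩ : LocalChar (Trunc k 4))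
      (psiTilde 4 ψ₀) = π ^ n * κ * (Fintype.card k : ℂ) ^ 2 := by
  unfold LocalChar.eps LocalChar.gauss
  rw [gaussSum_twist_four h2 h3 ψ₀ h₀]

/-- **At `s = ½` the root number of the conductor-`4` twist is EXACTLY `ρ(ϖ)^n`**: with `κ |k|² = 1`
(`κ = |R|^{−1/2} = |k|^{−2}`, `OcticCMPointKappa.lean`). -/
theorem eps_twist_four_half [Fintype k] [DecidableEq k] (h2 : (2 : k) ≠ 0) (h3 : (3 : k) ≠ 0)
    (ψ₀ : AddChar k ℂ) (h₀ : ψ₀.IsPrimitive) (κ : ℂ) (hκ : κ * (Fintype.card k : ℂ) ^ 2 = 1) (n : ℕ) (π : ℂ) :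
    LocalChar.eps κ n (⟨twist 4 (by norm_num) (by norm_num) h2 h3 1 ψ₀, π⟩ : LocalChar (Trunc k 4))
      (psiTilde 4 ψ₀) = π ^ n := by
  rw [eps_twist_four h2 h3 ψ₀ h₀ κ n π, mul_assoc, hκ, mul_one]

/-- **The twisted tame lines**: gen 1's stability (`eps_mul_eq`, ROUTE-B §9.9 (d)) on `I = (ϖ²)` with the
primitive twist (`a = 1`) and a shallow tame line `χ = ⟨tame θ, χ(ϖ)⟩` gives
`ε(½, χρ, ψ̃) = χ(ϖ)^n · ε(½, ρ, ψ̃) = (χ(ϖ) ρ(ϖ))^n` — (E2) at `𝔭 | 5` for the twisted tame lines in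
closed form. -/
theorem eps_tame_twist_four [Fintype k] [DecidableEq k] (h2 : (2 : k) ≠ 0) (h3 : (3 : k) ≠ 0)
    (ψ₀ : AddChar k ℂ) (h₀ : ψ₀.IsPrimitive) (κ : ℂ) (hκ : κ * (Fintype.card k : ℂ) ^ 2 = 1) (n : ℕ)
    (θ : MulChar k ℂ) (πχ π : ℂ) :
    LocalChar.eps κ n ((⟨tame 4 (by norm_num) θ, πχ⟩ : LocalChar (Trunc k 4)) *
      ⟨twist 4 (by norm_num) (by norm_num) h2 h3 1 ψ₀, π⟩) (psiTilde 4 ψ₀) = (πχ * π) ^ n := by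
  rw [LocalChar.eps_mul_eq κ n _ _ (psiTilde 4 ψ₀) (Ideal.span {(varpi 4 : Trunc k 4) ^ 2})
    (pow_mul_eq_zero_of_le 4 2 (by norm_num)) 1
    (primitive_twist 4 (by norm_num) (by norm_num) h2 h3 1 ψ₀ π 2 (by norm_num) (by norm_num))
    (shallow_tame 4 (by norm_num) θ ψ₀ h₀ πχ 2 (by norm_num)),
    eps_twist_four_half h2 h3 ψ₀ h₀ κ hκ n π, LocalChar.cRho, Units.val_one, MulChar.map_one, inv_one, mul_one,
    mul_pow]

/-- **(E3) at `𝔭 | 5` for four tame lines twisted by the conductor-`4` twist, in closed form**: with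
`χ′_j = ⟨tame θ_j, π_j⟩` and the `ϖ`-value part of N2, `π₀ π₁ = π₂ π₃`,
`ε(χ′₀ρ) ε(χ′₁ρ) = (π₀ π₁ π²)^n = ε(χ′₂ρ) ε(χ′₃ρ)`. -/
theorem E3_tame_twist_four [Fintype k] [DecidableEq k] (h2 : (2 : k) ≠ 0) (h3 : (3 : k) ≠ 0)
    (ψ₀ : AddChar k ℂ) (h₀ : ψ₀.IsPrimitive) (κ : ℂ) (hκ : κ * (Fintype.card k : ℂ) ^ 2 = 1) (n : ℕ)
    (θ : Fin 4 → MulChar k ℂ) (π' : Fin 4 → ℂ) (π : ℂ) (hN2 : π' 0 * π' 1 = π' 2 * π' 3) :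
    LocalChar.eps κ n ((⟨tame 4 (by norm_num) (θ 0), π' 0⟩ : LocalChar (Trunc k 4)) *
        ⟨twist 4 (by norm_num) (by norm_num) h2 h3 1 ψ₀, π⟩) (psiTilde 4 ψ₀) *
      LocalChar.eps κ n ((⟨tame 4 (by norm_num) (θ 1), π' 1⟩ : LocalChar (Trunc k 4)) *
        ⟨twist 4 (by norm_num) (by norm_num) h2 h3 1 ψ₀, π⟩) (psiTilde 4 ψ₀) =
    LocalChar.eps κ n ((⟨tame 4 (by norm_num) (θ 2), π' 2⟩ : LocalChar (Trunc k 4)) *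
        ⟨twist 4 (by norm_num) (by norm_num) h2 h3 1 ψ₀, π⟩) (psiTilde 4 ψ₀) *
      LocalChar.eps κ n ((⟨tame 4 (by norm_num) (θ 3), π' 3⟩ : LocalChar (Trunc k 4)) *
        ⟨twist 4 (by norm_num) (by norm_num) h2 h3 1 ψ₀, π⟩) (psiTilde 4 ψ₀) := by
  rw [eps_tame_twist_four h2 h3 ψ₀ h₀ κ hκ n, eps_tame_twist_four h2 h3 ψ₀ h₀ κ hκ n,
    eps_tame_twist_four h2 h3 ψ₀ h₀ κ hκ n, eps_tame_twist_four h2 h3 ψ₀ h₀ κ hκ n, ← mul_pow, ← mul_pow]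
  congr 1
  linear_combination (π * π) * hN2

/-- **The conjugate-orthogonal twist** (ROUTE-B §9.12 (c): `ρ|_{k_v^×} = 1`, so `ρ(N ϖ) = ρ(−ϖ²) = 1` and
`ρ(ϖ)² = ρ(−1) = 1`): its conductor-`4` root number is `ρ(ϖ)^n ∈ {±1}`. -/
theorem eps_twist_four_sign [Fintype k] [DecidableEq k] (h2 : (2 : k) ≠ 0) (h3 : (3 : k) ≠ 0)
    (ψ₀ : AddChar k ℂ) (h₀ : ψ₀.IsPrimitive) (κ : ℂ) (hκ : κ * (Fintype.card k : ℂ) ^ 2 = 1) (n : ℕ) (π : ℂ)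
    (hπ2 : π ^ 2 = 1) :
    LocalChar.eps κ n (⟨twist 4 (by norm_num) (by norm_num) h2 h3 1 ψ₀, π⟩ : LocalChar (Trunc k 4))
        (psiTilde 4 ψ₀) = 1 ∨
      LocalChar.eps κ n (⟨twist 4 (by norm_num) (by norm_num) h2 h3 1 ψ₀, π⟩ : LocalChar (Trunc k 4))
        (psiTilde 4 ψ₀) = -1 := by
  rw [eps_twist_four_half h2 h3 ψ₀ h₀ κ hκ n π]
  have h1 : π * π = 1 := by rw [← sq]; exact hπ2
  rcases mul_self_eq_one_iff.1 h1 with h | h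
  · left; rw [h, one_pow]
  · rw [h]; exact neg_one_pow_eq_or ℂ n

/-- `κ |k|² = 1` at `𝔭₁, 𝔭₂ | 5` for `κ = 1/25` (`|R| = 5⁴`, `κ = |R|^{−1/2}`). -/
theorem kappa_mul_card_sq_p5 : ((1 / 25 : ℝ) : ℂ) * (Fintype.card (ZMod 5) : ℂ) ^ 2 = 1 := by
  rw [ZMod.card]
  norm_num

end TruncModel

end Summit.Ventures.HodgeRepro.PeriodCloser

end
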